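import Literature.Topology.FourManifolds.ChordHost
import Literature.Topology.FourManifolds.CrossingLevels
import HarnessLib

/-!
# Wall references: the host and the bent knots of a clear wall frame, pointwise

Topic `Literature/Topology/FourManifolds` (trunk T-4MAN). Fact seat
`provefact-Literature.Topology.FourManifolds.Knot.IsConnectedSum.isIsotopic` (Schubert's theorem),
geometric heart for rail knots, segment conjugations. A **wall reference** `b.WallRef hcross ε r A' κ F`
packages a uniform shrink scale of `b`, a clear wall frame `F` of it which is the spiked piece
function on the extended native zone `[parLo (-7/2), parHi (-5/4)]`, and the hemisphere hypotheses
(instances: the spiked rail frame itself; the spiked flip frames of `FlipWall.lean`; the frame of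
`FrameC.lean`). For such a reference we describe pointwise

* the **reference host** `W.host` (`ExitHost.hostKnot` at `λ₀ = 1/2`, `r_A = 1/8`): the straight
  segment `ψ⁻¹ (o + clockFn u • d)` on the straight parameters `[strLo, winHi]` (`host_straight`),
  the bent arc `ψ⁻¹ (blowDown (bendArc σ (1/8) (psiHi t') 1))` on `[winHi, juncHi]` (`host_arc`),
  the frame off the content;
* the **bent knots** `W.bent hl₀ hrA` at every unit scale: the lower and upper straight pieces, the
  upper arc, the general content, the spiral correspondence with reference host points
  (`bent_spiral`), and `bent = host` off the content.

These are the inputs of the segment conjugation frames (`SegFrame.lean`).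

Everything is proved; no named facts are introduced.

## References

* M. W. Hirsch, *Differential Topology*, GTM 33 (1976), Ch. 8 §1. [HirschDT1976]
-/

open scoped Manifold ContDiff Topology Real
open Function Set Metric Filter

noncomputable section

namespace Literature.Topology.FourManifolds

/-- Local notation: `𝔼 n` is the model Euclidean space `EuclideanSpace ℝ (Fin n)`. -/
local notation "𝔼 " n:arg => EuclideanSpace ℝ (Fin n)

/-- Local notation: `𝕊 n` is the unit sphere in `EuclideanSpace ℝ (Fin (n + 1))`. -/
local notation "𝕊 " n:arg => (Metric.sphere (0 : EuclideanSpace ℝ (Fin (n + 1))) 1)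

attribute [local instance] fact_finrank_euclideanSpace_succ

open KnotsInBall ExitBend

namespace ExitBend

/-- **The bend arc at time one stays within `|ρ| (‖dLo‖ + ‖dHi‖)` of the centre.** [folklore] -/
theorem norm_bendArc_one_sub_cO_le (σ rA ρ : ℝ) : ‖bendArc σ rA ρ 1 - cO σ‖ ≤ |ρ| * (‖dLo σ‖ + ‖dHi σ‖) := by
  rw [bendArc]
  set x := π / 2 * annulusCut rA (ρ ^ 2) * 1
  have e : cO σ + (ρ * Real.sin x) • dLo σ + (ρ * Real.cos x) • dHi σ - cO σ = (ρ * Real.sin x) • dLo σ + (ρ * Real.cos x) • dHi σ := by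
    abel
  rw [e]
  refine (norm_add_le _ _).trans ?_
  rw [norm_smul, norm_smul, Real.norm_eq_abs, Real.norm_eq_abs, abs_mul, abs_mul]
  have hs := Real.abs_sin_le_one x
  have hc := Real.abs_cos_le_one x
  have h1 : |ρ| * |Real.sin x| * ‖dLo σ‖ ≤ |ρ| * ‖dLo σ‖ := by
    have := mul_le_mul_of_nonneg_left hs (abs_nonneg ρ)
    exact mul_le_mul_of_nonneg_right (by nlinarith [abs_nonneg ρ]) (norm_nonneg _)
  have h2 : |ρ| * |Real.cos x| * ‖dHi σ‖ ≤ |ρ| * ‖dHi σ‖ := by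
    exact mul_le_mul_of_nonneg_right (by nlinarith [abs_nonneg ρ]) (norm_nonneg _)
  linarith

/-- **The bent rays of radius `≥ 1/2` agree for all bend radii `≤ 1/4`.** [folklore] -/
theorem bendArc_one_eq_of_half_le (σ : ℝ) {rA rA' ρ : ℝ} (hrA : 0 < rA) (hrA4 : rA ≤ 1 / 4) (hrA' : 0 < rA') (hrA4' : rA' ≤ 1 / 4)
    (hρ : 1 / 2 ≤ ρ) : bendArc σ rA ρ 1 = bendArc σ rA' ρ 1 := by
  have h1 : 4 * rA ^ 2 ≤ ρ ^ 2 := by nlinarith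
  have h2 : 4 * rA' ^ 2 ≤ ρ ^ 2 := by nlinarith
  simp only [bendArc, annulusCut_eq_of_le hrA h1, annulusCut_eq_of_le hrA' h2]

end ExitBend

namespace BandData


/-- The blown-up parameters are monotone globally (`κ > 0`). [folklore] -/
theorem alphaLo_monotone' {A B K : Knot} (b : BandData A B K ∅) {κ : ℝ} (hκ : 0 < κ) : Monotone (b.alphaLo κ) := fun s t hst ↦ by
  simp only [alphaLo]
  exact div_le_div_of_nonneg_right (by linarith [b.monotone_chiLo hst]) hκ.le

/-- The upper blown-up parameter is antitone globally (`κ > 0`). [folklore] -/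
theorem alphaHi_antitone' {A B K : Knot} (b : BandData A B K ∅) {κ : ℝ} (hκ : 0 < κ) : Antitone (b.alphaHi κ) := fun s t hst ↦ by
  simp only [alphaHi]
  exact div_le_div_of_nonneg_right (by linarith [b.antitone_chiHi hst]) hκ.le

/-! ### Frame independence on the content -/

section Congr

variable {A B K : Knot} (b : BandData A B K ∅)
  {hcross : b.band ⁻¹' sphereEquator 2 ∩ squareNhd b.δ = {x ∈ squareNhd b.δ | x 0 = 2⁻¹}}
  {ε r A' κ : ℝ} (HU : b.ShrinkScaleU hcross ε r A' κ) {F F' : ℝ → 𝔼 4}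
  (hW : b.IsWallFrame HU.cone F) (hW' : b.IsWallFrame HU.cone F')
  {lam₀ rA : ℝ} (hl : lam₀ ∈ Ioc (0 : ℝ) 1) (hl2 : lam₀ ≤ 1 / 2) (hrA : 0 < rA) (hrA8 : rA ≤ 1 / 8)
  (hB : B.InSouth) (hAB : Disjoint (range A) (range B))

include hW hW' in
/-- **On the content two wall frames agree** (both are the spiked piece function). [folklore] -/
theorem frame_eq_of_mem_content {t : ℝ}
    (ht : t ∈ b.contentSet HU.cone.spike.κ_pos HU.cone.spike.seven_le_gapLo HU.cone.spike.seven_le_gapHi) : F t = F' t := by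
  have h := HU.cone.spike
  have hκ := h.κ_pos
  obtain ⟨-, hjlv⟩ := b.juncLo_spec hκ h.seven_le_gapLo
  obtain ⟨-, hjhv⟩ := b.juncHi_spec hκ h.seven_le_gapHi
  have h1 : 1 / 4 < b.alphaLo κ t := by
    have := b.alphaLo_monotone' hκ ht.1; rw [hjlv] at this; linarith
  have h2 : 1 / 4 < b.alphaHi κ t := by
    have := b.alphaHi_antitone' hκ ht.2; rw [hjhv] at this; linarith
  rw [hW.agree t h1 h2, hW'.agree t h1 h2]

/-- **The bent knots of two wall frames agree wherever the frames agree** (fundamental domain).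
[folklore] -/
theorem bentKnot_circlePt_congr {t : ℝ} (ht : t ∈ Ico b.alo (b.alo + 1)) (he : F t = F' t) :
    b.bentKnot HU hW hl hrA hB hAB (circlePt t) = b.bentKnot HU hW' hl hrA hB hAB (circlePt t) := by
  rw [b.bentKnot_circlePt HU hW hl hrA hB hAB, b.bentKnot_circlePt HU hW' hl hrA hB hAB]
  congr 1
  apply Subtype.ext
  rw [b.coe_wallShrinkKnotU_circlePt_of_mem HU hW hl hB hAB ht, b.coe_wallShrinkKnotU_circlePt_of_mem HU hW' hl hB hAB ht,
    wallScalePiece, wallScalePiece, he]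

/-- **The bent knots of two wall frames agree on the content.** [folklore] -/
theorem bentKnot_circlePt_congr_of_mem {t : ℝ}
    (ht : t ∈ b.contentSet HU.cone.spike.κ_pos HU.cone.spike.seven_le_gapLo HU.cone.spike.seven_le_gapHi) :
    b.bentKnot HU hW hl hrA hB hAB (circlePt t) = b.bentKnot HU hW' hl hrA hB hAB (circlePt t) := by
  have hjl := b.juncLo_mem_core HU.cone.spike.κ_pos HU.cone.spike.seven_le_gapLo
  have hjh := b.juncHi_mem_core HU.cone.spike.κ_pos HU.cone.spike.seven_le_gapHi
  obtain ⟨c1, c2, c3⟩ := b.core_marks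
  have hc : b.juncLo HU.cone.spike.κ_pos HU.cone.spike.seven_le_gapLo ≤ t ∧ t ≤ b.juncHi HU.cone.spike.κ_pos HU.cone.spike.seven_le_gapHi := ht
  exact b.bentKnot_circlePt_congr HU hW hW' hl hrA hB hAB ⟨by linarith [hjl.1, hc.1], by linarith [hjh.2, hc.2]⟩
    (b.frame_eq_of_mem_content HU hW hW' ht)

include hW' hrA8 in
/-- **The host loops of two wall frames agree on the content.** [folklore] -/
theorem hostLoop_congr_of_mem {t : ℝ}
    (ht : t ∈ b.contentSet HU.cone.spike.κ_pos HU.cone.spike.seven_le_gapLo HU.cone.spike.seven_le_gapHi) :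
    b.hostLoop HU hl hl2 hW hrA hB hAB t = b.hostLoop HU hl hl2 hW' hrA hB hAB t := by
  have hjl := b.juncLo_mem_core HU.cone.spike.κ_pos HU.cone.spike.seven_le_gapLo
  have hjh := b.juncHi_mem_core HU.cone.spike.κ_pos HU.cone.spike.seven_le_gapHi
  obtain ⟨c1, c2, c3⟩ := b.core_marks
  have hc : b.juncLo HU.cone.spike.κ_pos HU.cone.spike.seven_le_gapLo ≤ t ∧ t ≤ b.juncHi HU.cone.spike.κ_pos HU.cone.spike.seven_le_gapHi := ht
  have hI : t ∈ Ico b.alo (b.alo + 1) := ⟨by linarith [hjl.1, hc.1], by linarith [hjh.2, hc.2]⟩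
  by_cases hw : t ∈ Icc (b.winLo HU hl) (b.winHi HU hl)
  · rw [b.hostLoop_of_mem_window HU hl hl2 hW hrA hrA8 hB hAB hw, b.hostLoop_of_mem_window HU hl hl2 hW' hrA hrA8 hB hAB hw]
  · have hcol : t ∉ Ioo (b.collarLo HU hl) (b.collarHi HU hl) := fun h ↦ hw
      ⟨by linarith [h.1, b.winLo_lt_collarLo HU hl hl2], by linarith [h.2, b.collarHi_lt_winHi HU hl hl2]⟩
    rw [b.hostLoop_of_not_mem_collar HU hl hl2 hW hrA hrA8 hB hAB hI hcol, b.hostLoop_of_not_mem_collar HU hl hl2 hW' hrA hrA8 hB hAB hI hcol,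
      Knot.curve_apply, Knot.curve_apply, b.bentKnot_circlePt_congr_of_mem HU hW hW' hl hrA hB hAB ht]

end Congr

variable {A B K : Knot} {b : BandData A B K ∅}
  {hcross : b.band ⁻¹' sphereEquator 2 ∩ squareNhd b.δ = {x ∈ squareNhd b.δ | x 0 = 2⁻¹}}

variable (b hcross) in
/-- **A wall reference**: a uniform shrink scale, a clear wall frame `F` equal to the spiked piece
function on the extended native zone, hemispheres. [folklore] -/
structure WallRef (ε r A' κ : ℝ) (F : ℝ → 𝔼 4) : Prop where
  HU : b.ShrinkScaleU hcross ε r A' κ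
  hW : b.IsWallFrame HU.cone F
  hclear : b.IsBendClear HU.cone F
  native : ∀ s ∈ Icc (b.parLo HU.cone.spike.κ_pos HU.cone.spike.seven_le_gapLo neg_seven_halves_mem)
    (b.parHi HU.cone.spike.κ_pos HU.cone.spike.seven_le_gapHi neg_five_quarters_mem), F s = b.spikePiece hcross κ b.depthSign 1 s
  hA : A.InNorth
  hB : B.InSouth
  hAB : Disjoint (range A) (range B)

namespace WallRef

variable {ε r A' κ : ℝ} {F : ℝ → 𝔼 4} (W : b.WallRef hcross ε r A' κ F)
  {lam₀ rA : ℝ} (hl₀ : lam₀ ∈ Ioc (0 : ℝ) 1) (hl₀2 : lam₀ ≤ 1 / 2) (hrA : 0 < rA) (hrA8 : rA ≤ 1 / 8)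
include W

/-! ### Scale facts and marks -/

/-- `0 < κ`. [folklore] -/
theorem κ_pos : 0 < κ := W.HU.cone.spike.κ_pos

omit W in
/-- `1/2 ∈ (0, 1]`. [folklore] -/
theorem half_mem : (1 / 2 : ℝ) ∈ Ioc (0 : ℝ) 1 := ⟨by norm_num, by norm_num⟩

omit W in
/-- `0 < 1/8`. [folklore] -/
theorem eighth_pos : (0 : ℝ) < 1 / 8 := by norm_num

/-- The lower junction. [folklore] -/
def jLo : ℝ := b.juncLo W.κ_pos W.HU.cone.spike.seven_le_gapLo
/-- The upper junction. [folklore] -/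
def jHi : ℝ := b.juncHi W.κ_pos W.HU.cone.spike.seven_le_gapHi

/-- The content set is `[jLo, jHi]`. [folklore] -/
theorem contentSet_eq : b.contentSet W.κ_pos W.HU.cone.spike.seven_le_gapLo W.HU.cone.spike.seven_le_gapHi = Icc W.jLo W.jHi := rfl

/-! ### The reference host and the bent knots -/

/-- **The reference host** (`λ₀ = 1/2`, `r_A = 1/8`). [folklore] -/
def host : Knot := b.hostKnot W.HU half_mem (by norm_num) W.hW (rA := 1 / 8) eighth_pos le_rfl W.hB W.hAB W.hclear W.hA

/-- The reference host loop. [folklore] -/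
def hostLoop : ℝ → 𝔼 4 := b.hostLoop W.HU half_mem (by norm_num) W.hW (rA := 1 / 8) eighth_pos W.hB W.hAB

/-- The host on circle points. [folklore] -/
theorem coe_host_circlePt (t : ℝ) : ((W.host (circlePt t) : 𝕊 3) : 𝔼 4) = W.hostLoop t :=
  b.coe_hostKnot_circlePt _ _ _ _ _ _ _ _ _ _ t

/-- **The bent knot at unit scale `λ₀`, bend radius `r_A`.** [folklore] -/
def bent (hl₀ : lam₀ ∈ Ioc (0 : ℝ) 1) (hrA : 0 < rA) : Knot := b.bentKnot W.HU W.hW hl₀ hrA W.hB W.hAB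

/-- **The segment centre** `oS = blowDown O`. [folklore] -/
def segO (_ : b.WallRef hcross ε r A' κ F) : 𝔼 3 := b.oS hcross κ b.depthSign

/-- **The segment direction** `κ frame dLo`. [folklore] -/
def segD (_ : b.WallRef hcross ε r A' κ F) : 𝔼 3 := κ • b.frame hcross (dLo b.depthSign)

/-- `blowDown (O + ρ dLo) = o + ρ d`. [folklore] -/
theorem blowDown_lowerPt (ρ : ℝ) : b.blowDown hcross κ (lowerPt b.depthSign ρ) = W.segO + ρ • W.segD := by
  simp only [segO, segD, oS, lowerPt, blowDown, map_add, map_smul, smul_add, smul_smul, mul_comm ρ κ]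
  rw [add_assoc]
  rfl

/-- The segment direction is nonzero. [folklore] -/
theorem segD_ne_zero : W.segD ≠ 0 := by
  have hκ := W.κ_pos
  have hd : dLo b.depthSign ≠ 0 := fun h ↦ by
    have := norm_dLo_sq b.depthSign_sq; rw [h, norm_zero] at this; norm_num at this
  simp only [segD]
  refine smul_ne_zero hκ.ne' fun h0 ↦ hd ((b.frame hcross).injective ?_)
  rw [h0, map_zero]

/-- The stub base relative to the centre: `blowDown (1/4, -1, 0) - oS = -d`. [folklore] -/
theorem baseLo_sub_oS : b.blowDown hcross κ (pt3 (1 / 4) (-1) 0) - b.oS hcross κ b.depthSign = -W.segD := by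
  rw [oS, b.blowDown_sub, segD, ← smul_neg, ← map_neg]
  congr 2
  ext i; fin_cases i <;> (simp [pt3, dLo]; try norm_num)

/-! ### Off the content -/

/-- **Off the content the bent knot is the frame, at every scale.** [folklore] -/
theorem coe_bent_of_not_mem {t : ℝ} (ht : t ∈ Ico b.alo (b.alo + 1)) (hts : t ∉ Icc W.jLo W.jHi) :
    ((W.bent hl₀ hrA (circlePt t) : 𝕊 3) : 𝔼 4) = F t :=
  b.bentKnot_circlePt_of_not_mem W.HU W.hW W.hclear W.hA hl₀ hrA W.hB W.hAB ht hts

/-- **Off the content the reference host is the frame.** [folklore] -/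
theorem hostLoop_of_not_mem {t : ℝ} (ht : t ∈ Ico b.alo (b.alo + 1)) (hts : t ∉ Icc W.jLo W.jHi) : W.hostLoop t = F t := by
  have hwin := b.window_subset_contentSet W.HU half_mem (by norm_num : (1 / 2 : ℝ) ≤ 1 / 2)
  have hcol : t ∉ Ioo (b.collarLo W.HU half_mem) (b.collarHi W.HU half_mem) := fun h ↦ hts (hwin
    ⟨by linarith [h.1, b.winLo_lt_collarLo W.HU half_mem (by norm_num)], by linarith [h.2, b.collarHi_lt_winHi W.HU half_mem (by norm_num)]⟩)
  rw [hostLoop, b.hostLoop_of_not_mem_collar W.HU half_mem (by norm_num) W.hW eighth_pos le_rfl W.hB W.hAB ht hcol, Knot.curve_apply]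
  exact b.bentKnot_circlePt_of_not_mem W.HU W.hW W.hclear W.hA half_mem eighth_pos W.hB W.hAB ht hts

/-- **Off the content the bent knot is the reference host.** [folklore] -/
theorem bent_of_not_mem {t : ℝ} (ht : t ∈ Ico b.alo (b.alo + 1)) (hts : t ∉ Icc W.jLo W.jHi) :
    W.bent hl₀ hrA (circlePt t) = W.host (circlePt t) :=
  Subtype.ext (by rw [W.coe_bent_of_not_mem hl₀ hrA ht hts, W.coe_host_circlePt, W.hostLoop_of_not_mem ht hts])

/-! ### The straight pieces of the bent knots -/

/-- **The lower stub of the bent knot is straight, at every scale**: for a lower-core parameter with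
`αLo ∈ [1/4, 3/8)` (off the content), `bent (circlePt t) = ψ⁻¹ (o + (-psiLo t) d)`. [folklore] -/
theorem bent_stub {t : ℝ} (ht : t ∈ Icc (b.tcLo - b.epsLo / 8) (b.tcLo + b.epsLo / 8)) (hα : b.alphaLo κ t ∈ Ico (1 / 4 : ℝ) (3 / 8)) :
    W.bent hl₀ hrA (circlePt t) = psiN.symm (W.segO + (-b.psiLo κ lam₀ t) • W.segD) := by
  have hκ := W.κ_pos
  obtain ⟨c1, c2, c3⟩ := b.core_marks
  have hjl := (b.juncLo_spec hκ W.HU.cone.spike.seven_le_gapLo)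
  have hlt : t < W.jLo := by
    by_contra hle; push Not at hle
    have := (b.strictMonoOn_alphaLo hκ).monotoneOn (b.juncLo_mem_core hκ W.HU.cone.spike.seven_le_gapLo) ht hle
    rw [hjl.2] at this
    linarith [hα.2]
  have hI : t ∈ Ico b.alo (b.alo + 1) := ⟨by linarith [ht.1], by linarith [ht.2, c2, c3, b.epsHi_bounds.1]⟩
  have hz : t ∈ Icc (b.parLo hκ W.HU.cone.spike.seven_le_gapLo neg_seven_halves_mem) (b.parHi hκ W.HU.cone.spike.seven_le_gapHi neg_five_quarters_mem) := by
    constructor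
    · exact ((b.le_alphaLo_iff' hκ W.HU.cone.spike.seven_le_gapLo neg_seven_halves_mem ht).1 (by linarith [hα.1]))
    · have := (b.parHi_mem_core hκ W.HU.cone.spike.seven_le_gapHi neg_five_quarters_mem).1; linarith [ht.2]
  apply Subtype.ext
  rw [W.coe_bent_of_not_mem hl₀ hrA hI (fun h ↦ by linarith [h.1]), W.native t hz,
    b.spikePiece_coreLo hcross hκ W.HU.cone.spike.κ_le W.HU.cone.spike.eight_le_poleRad b.depthSign 1 ht (by rw [abs_lt]; constructor <;> linarith [hα.1, hα.2]),
    spikePtLo, b.pieceLo_one_eq_lineLo hcross ⟨hα.1, by linarith [hα.2]⟩]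
  have e : lineLo b.depthSign (b.alphaLo κ t) = lowerPt b.depthSign (-b.psiLo κ lam₀ t) := by
    rw [psiLo, spikeScalar_of_le_seven_sixteenths _ (show b.alphaLo κ t ≤ 7 / 16 by linarith [hα.2]), lineLo, lowerPt]
    ext i; fin_cases i <;> (simp [pt3, cO, dLo]; ring)
  rw [e, W.blowDown_lowerPt]

/-- **The lower straight piece of the bent knot** (`αLo ∈ [1/4, 3/4]`):
`bent (circlePt t) = ψ⁻¹ (o + (-psiLo t) d)`. [folklore] -/
theorem bent_lowerStraight {t : ℝ} (ht : t ∈ Icc (b.tcLo - b.epsLo / 8) (b.tcLo + b.epsLo / 8))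
    (hα : b.alphaLo κ t ∈ Icc (1 / 4 : ℝ) (3 / 4)) :
    W.bent hl₀ hrA (circlePt t) = psiN.symm (W.segO + (-b.psiLo κ lam₀ t) • W.segD) := by
  rcases lt_or_ge (b.alphaLo κ t) (3 / 8) with h1 | h1
  · exact W.bent_stub hl₀ hrA ht ⟨hα.1, h1⟩
  · apply Subtype.ext
    rw [bent, b.bentKnot_circlePt_lowerSpike W.HU W.hW hl₀ hrA W.hB W.hAB ht ⟨h1, hα.2⟩, W.baseLo_sub_oS, psiLo, smul_neg, ← neg_smul]
    rfl

include hrA8 in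
/-- **The upper straight piece of the bent knot** (`αHi ∈ [3/8, 3/4]`, `psiHi t ∈ [2 r_A, 1/2]`):
`bent (circlePt t) = ψ⁻¹ (o + psiHi t • d)`. [folklore] -/
theorem bent_upperStraight {t : ℝ} (ht : t ∈ Icc (b.tcHi - b.epsHi / 8) (b.tcHi + b.epsHi / 8))
    (hα : b.alphaHi κ t ∈ Icc (3 / 8 : ℝ) (3 / 4)) (hψ : b.psiHi κ lam₀ t ∈ Icc (2 * rA) (1 / 2)) :
    W.bent hl₀ hrA (circlePt t) = psiN.symm (W.segO + b.psiHi κ lam₀ t • W.segD) := by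
  apply Subtype.ext
  have e : cO b.depthSign + spikeScalar (1 * (1 - lam₀)) (b.alphaHi κ t) • dLo b.depthSign =
      lowerPt b.depthSign (spikeScalar (1 * (1 - lam₀)) (b.alphaHi κ t)) := rfl
  rw [bent, b.bentKnot_circlePt_upperSpike_of_mem W.HU W.hW hl₀ hrA (by linarith) W.hB W.hAB ht hα hψ, e, W.blowDown_lowerPt]
  rfl

/-- **The upper arc piece of the bent knot** (`αHi ∈ [3/8, 3/4]`): the blown-down bend arc, a chart
point within `κ ‖frame‖ |psiHi t| (‖dLo‖ + ‖dHi‖)` of the segment centre. [folklore] -/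
theorem bent_upperArc {t : ℝ} (ht : t ∈ Icc (b.tcHi - b.epsHi / 8) (b.tcHi + b.epsHi / 8))
    (hα : b.alphaHi κ t ∈ Icc (3 / 8 : ℝ) (3 / 4)) :
    W.bent hl₀ hrA (circlePt t) = psiN.symm (b.blowDown hcross κ (bendArc b.depthSign rA (b.psiHi κ lam₀ t) 1)) ∧
      ‖b.blowDown hcross κ (bendArc b.depthSign rA (b.psiHi κ lam₀ t) 1) - W.segO‖ ≤
        κ * ‖((b.frame hcross : (𝔼 3) ≃L[ℝ] 𝔼 3) : (𝔼 3) →L[ℝ] 𝔼 3)‖ * (|b.psiHi κ lam₀ t| * (‖dLo b.depthSign‖ + ‖dHi b.depthSign‖)) := by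
  have hκ := W.κ_pos
  refine ⟨Subtype.ext ?_, ?_⟩
  · rw [bent, b.bentKnot_circlePt_upperSpike W.HU W.hW hl₀ hrA W.hB W.hAB ht hα]; rfl
  · have e : b.blowDown hcross κ (bendArc b.depthSign rA (b.psiHi κ lam₀ t) 1) - W.segO =
        κ • b.frame hcross (bendArc b.depthSign rA (b.psiHi κ lam₀ t) 1 - cO b.depthSign) := by
      simp only [segO, oS, blowDown, cO, map_sub, smul_sub]; abel
    have hNF : 0 ≤ ‖((b.frame hcross : (𝔼 3) ≃L[ℝ] 𝔼 3) : (𝔼 3) →L[ℝ] 𝔼 3)‖ := norm_nonneg _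
    rw [e, norm_smul, Real.norm_eq_abs, abs_of_pos hκ, mul_assoc]
    refine mul_le_mul_of_nonneg_left ?_ hκ.le
    refine (ContinuousLinearMap.le_opNorm _ _).trans (mul_le_mul_of_nonneg_left ?_ hNF)
    simp only [psiHi]
    exact norm_bendArc_one_sub_cO_le _ _ _

/-- **The general content of the bent knot** (`αLo, αHi > 3/4`, `λ₀ (9 + 4 ‖frame⁻¹‖ / κ) ≤ r_A`):
the shrunk knot, within `λ₀ κ ‖frame‖ (9 + 4 ‖frame⁻¹‖ / κ)` of the segment centre. [folklore] -/
theorem bent_general (hsmall : lam₀ * (9 + 4 * ‖(((b.frame hcross).symm : (𝔼 3) ≃L[ℝ] 𝔼 3) : (𝔼 3) →L[ℝ] 𝔼 3)‖ / κ) ≤ rA)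
    {t : ℝ} (hs : t ∈ Icc W.jLo W.jHi) (h1 : 3 / 4 < b.alphaLo κ t) (h2 : 3 / 4 < b.alphaHi κ t) :
    ∃ y : 𝔼 3, W.bent hl₀ hrA (circlePt t) = psiN.symm y ∧
      ‖y - W.segO‖ ≤ lam₀ * (κ * ‖((b.frame hcross : (𝔼 3) ≃L[ℝ] 𝔼 3) : (𝔼 3) →L[ℝ] 𝔼 3)‖ *
        (9 + 4 * ‖(((b.frame hcross).symm : (𝔼 3) ≃L[ℝ] 𝔼 3) : (𝔼 3) →L[ℝ] 𝔼 3)‖ / κ)) := by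
  have hκ := W.κ_pos
  set Y := b.Ypt W.HU.cone t
  refine ⟨b.oS hcross κ b.depthSign + lam₀ • (Y - b.oS hcross κ b.depthSign), Subtype.ext ?_, ?_⟩
  · rw [bent, b.bentKnot_circlePt_general W.HU W.hW hl₀ hrA W.hB W.hAB hsmall hs h1 h2]
  · rw [segO, add_sub_cancel_left, norm_smul, Real.norm_eq_abs, abs_of_pos hl₀.1]
    refine mul_le_mul_of_nonneg_left ?_ hl₀.1.le
    have e : Y - b.oS hcross κ b.depthSign = κ • b.frame hcross (b.blowUp hcross κ Y - cO b.depthSign) := by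
      conv_lhs => rw [← b.blowDown_blowUp hcross hκ.ne' Y]
      simp only [oS, blowDown, cO, map_sub, smul_sub]; abel
    have hNF : 0 ≤ ‖((b.frame hcross : (𝔼 3) ≃L[ℝ] 𝔼 3) : (𝔼 3) →L[ℝ] 𝔼 3)‖ := norm_nonneg _
    rw [e, norm_smul, Real.norm_eq_abs, abs_of_pos hκ, mul_assoc]
    refine mul_le_mul_of_nonneg_left ?_ hκ.le
    refine (ContinuousLinearMap.le_opNorm _ _).trans (mul_le_mul_of_nonneg_left ?_ hNF)
    have hY := b.norm_blowUp_Ypt_le W.HU W.hB hs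
    have hO : ‖cO b.depthSign‖ ≤ 2 := norm_cO_le _ b.abs_depthSign_le
    have := norm_sub_le (b.blowUp hcross κ Y) (cO b.depthSign)
    linarith

/-! ### Ray scalars: localisation and monotonicity -/

omit W in
include hl₀ in
/-- **Localisation by the upper ray scalar**: if `psiHi t ∈ (λ₀/3, 5/6]` then `αHi t ∈ [3/8, 3/4)`.
[folklore] -/
theorem alphaHi_mem_of_psiHi {t : ℝ} (hψ : b.psiHi κ lam₀ t ∈ Ioc (lam₀ / 3) (5 / 6)) : b.alphaHi κ t ∈ Ico (3 / 8 : ℝ) (3 / 4) := by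
  have hc := cOne_mem hl₀
  have hanti := strictAntiOn_spikeScalar hc
  simp only [psiHi] at hψ
  have hα1 : b.alphaHi κ t < 1 := by
    by_contra h; push Not at h
    have := spikeScalar_nonpos hc h; linarith [hψ.1, hl₀.1]
  constructor
  · by_contra h; push Not at h
    have := hanti (show b.alphaHi κ t ∈ Iio (1:ℝ) from hα1) (show (3/8:ℝ) ∈ Iio (1:ℝ) by norm_num) h
    rw [spikeScalar_three_eighths] at this; linarith [hψ.2]
  · by_contra h; push Not at h
    have h2 : spikeScalar (1 * (1 - lam₀)) (b.alphaHi κ t) ≤ spikeScalar (1 * (1 - lam₀)) (3 / 4) :=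
      hanti.antitoneOn (show (3/4:ℝ) ∈ Iio (1:ℝ) by norm_num) (show b.alphaHi κ t ∈ Iio (1:ℝ) from hα1) h
    rw [spikeScalar_three_quarters] at h2; linarith [hψ.1]

omit W in
include hl₀ in
/-- **The upper ray scalar on `[3/8, 3/4]ᵅ` lies in `[λ₀/3, 5/6]`.** [folklore] -/
theorem psiHi_mem_of_alphaHi {t : ℝ} (hα : b.alphaHi κ t ∈ Icc (3 / 8 : ℝ) (3 / 4)) : b.psiHi κ lam₀ t ∈ Icc (lam₀ / 3) (5 / 6) := by
  have hc := cOne_mem hl₀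
  have hanti := strictAntiOn_spikeScalar hc
  simp only [psiHi]
  refine ⟨?_, spikeScalar_le hc hα.1 (by linarith [hα.2])⟩
  have h2 : spikeScalar (1 * (1 - lam₀)) (3 / 4) ≤ spikeScalar (1 * (1 - lam₀)) (b.alphaHi κ t) :=
    hanti.antitoneOn (show b.alphaHi κ t ∈ Iio (1:ℝ) by simp only [mem_Iio]; linarith [hα.2]) (show (3/4:ℝ) ∈ Iio (1:ℝ) by norm_num) hα.2
  rw [spikeScalar_three_quarters] at h2; linarith

omit W in
include hl₀ in
/-- **The lower ray scalar on `[3/8, 3/4]ᵅ` lies in `[λ₀/3, 5/6]`.** [folklore] -/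
theorem psiLo_mem_of_alphaLo {t : ℝ} (hα : b.alphaLo κ t ∈ Icc (3 / 8 : ℝ) (3 / 4)) : b.psiLo κ lam₀ t ∈ Icc (lam₀ / 3) (5 / 6) := by
  have hc := cOne_mem hl₀
  have hanti := strictAntiOn_spikeScalar hc
  simp only [psiLo]
  refine ⟨?_, spikeScalar_le hc hα.1 (by linarith [hα.2])⟩
  have h2 : spikeScalar (1 * (1 - lam₀)) (3 / 4) ≤ spikeScalar (1 * (1 - lam₀)) (b.alphaLo κ t) :=
    hanti.antitoneOn (show b.alphaLo κ t ∈ Iio (1:ℝ) by simp only [mem_Iio]; linarith [hα.2]) (show (3/4:ℝ) ∈ Iio (1:ℝ) by norm_num) hα.2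
  rw [spikeScalar_three_quarters] at h2; linarith

omit W in
include hl₀ in
/-- **The lower ray scalar is strictly decreasing** on the lower core where `αLo < 1`. [folklore] -/
theorem psiLo_lt_psiLo_of_lt (hκ : 0 < κ) {s t : ℝ} (hs : s ∈ Icc (b.tcLo - b.epsLo / 8) (b.tcLo + b.epsLo / 8))
    (ht : t ∈ Icc (b.tcLo - b.epsLo / 8) (b.tcLo + b.epsLo / 8)) (hst : s < t) (hα1 : b.alphaLo κ t < 1) :
    b.psiLo κ lam₀ t < b.psiLo κ lam₀ s := by
  have hc := cOne_mem hl₀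
  have hlt := (b.strictMonoOn_alphaLo hκ) hs ht hst
  simp only [psiLo]
  exact strictAntiOn_spikeScalar hc (show b.alphaLo κ s ∈ Iio (1:ℝ) by simp only [mem_Iio]; linarith)
    (show b.alphaLo κ t ∈ Iio (1:ℝ) from hα1) hlt

omit W in
include hl₀ in
/-- **The upper ray scalar is strictly increasing** on the upper core where `αHi < 1`. [folklore] -/
theorem psiHi_lt_psiHi_of_lt (hκ : 0 < κ) {s t : ℝ} (hs : s ∈ Icc (b.tcHi - b.epsHi / 8) (b.tcHi + b.epsHi / 8))
    (ht : t ∈ Icc (b.tcHi - b.epsHi / 8) (b.tcHi + b.epsHi / 8)) (hst : s < t) (hα1 : b.alphaHi κ s < 1) :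
    b.psiHi κ lam₀ s < b.psiHi κ lam₀ t := by
  have hc := cOne_mem hl₀
  have hlt := (b.strictAntiOn_alphaHi hκ) hs ht hst
  simp only [psiHi]
  exact strictAntiOn_spikeScalar hc (show b.alphaHi κ t ∈ Iio (1:ℝ) by simp only [mem_Iio]; linarith)
    (show b.alphaHi κ s ∈ Iio (1:ℝ) from hα1) hlt

/-! ### The reference host on the straight parameters and on the arc -/

/-- The reference window end lies below the upper junction. [folklore] -/
theorem winHi_le_jHi : b.winHi W.HU half_mem ≤ W.jHi := by
  have hκ := W.κ_pos
  obtain ⟨hWc, hWv⟩ := b.clockHi_spec W.HU half_mem half_mem_Icc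
  obtain ⟨hjc, hjv⟩ := b.juncHi_spec hκ W.HU.cone.spike.seven_le_gapHi
  have hWv' : b.psiHi κ (1 / 2) (b.winHi W.HU half_mem) = 1 / 2 := hWv
  have hαw := (alphaHi_mem_of_psiHi half_mem (b := b) (t := b.winHi W.HU half_mem) (by rw [hWv']; norm_num)).1
  by_contra hlt; push Not at hlt
  have := (b.strictAntiOn_alphaHi hκ) ⟨hjc.1, by linarith [hjc.2, b.epsHi_bounds.1]⟩ (b.winHi_mem_core W.HU half_mem) hlt
  rw [hjv] at this
  linarith

/-- **THE REFERENCE HOST ON THE STRAIGHT PARAMETERS** `[strLo, winHi]`: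
`host (circlePt u) = ψ⁻¹ (o + clockFn u • d)`. [folklore] -/
theorem host_straight {u : ℝ} (hu : u ∈ Icc (b.strLo W.HU) (b.winHi W.HU half_mem)) :
    W.host (circlePt u) = psiN.symm (W.segO + b.clockFn W.HU half_mem (by norm_num) u • W.segD) := by
  have hκ := W.κ_pos
  have hl2 : (1 / 2 : ℝ) ≤ 1 / 2 := le_rfl
  obtain ⟨m1, m2, m3, m3', m4, m5⟩ := b.str_marks W.HU half_mem
  obtain ⟨c1, c2, c3⟩ := b.core_marks
  have hsl : b.strLo W.HU ∈ Icc (b.tcLo - b.epsLo / 8) (b.tcLo + b.epsLo / 8) := b.parLo_mem_core hκ W.HU.cone.spike.seven_le_gapLo quarter_mem7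
  have hwl := b.winLo_mem_core W.HU half_mem
  have hwh := b.winHi_mem_core W.HU half_mem
  have hI : u ∈ Ico b.alo (b.alo + 1) := ⟨by linarith [hu.1, hsl.1], by linarith [hu.2, hwh.2]⟩
  rcases lt_or_ge u (b.winLo W.HU half_mem) with h1 | h1
  · -- left of the window: the bent knot of the reference scale, lower straight piece
    have hcore : u ∈ Icc (b.tcLo - b.epsLo / 8) (b.tcLo + b.epsLo / 8) := ⟨by linarith [hu.1, hsl.1], by linarith [hwl.2]⟩
    have hα : b.alphaLo κ u ∈ Icc (1 / 4 : ℝ) (3 / 4) := by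
      constructor
      · rw [← b.alphaLo_parLo hκ W.HU.cone.spike.seven_le_gapLo quarter_mem7]
        exact (b.strictMonoOn_alphaLo hκ).monotoneOn hsl hcore hu.1
      · have := (b.alphaLo_clockLo_mem W.HU half_mem hl2 half_mem_Icc).2
        exact (((b.strictMonoOn_alphaLo hκ).monotoneOn hcore hwl h1.le)).trans this.le
    have hcol : u ∉ Ioo (b.collarLo W.HU half_mem) (b.collarHi W.HU half_mem) := fun h ↦ by
      linarith [h.1, b.winLo_lt_collarLo W.HU half_mem hl2]
    have e : W.host (circlePt u) = W.bent half_mem eighth_pos (circlePt u) := Subtype.ext (by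
      rw [W.coe_host_circlePt, hostLoop, b.hostLoop_of_not_mem_collar W.HU half_mem hl2 W.hW eighth_pos le_rfl W.hB W.hAB hI hcol,
        Knot.curve_apply]; rfl)
    rw [e, W.bent_lowerStraight half_mem eighth_pos hcore hα, b.clockFn_of_le_collarLo W.HU half_mem hl2 (by
      linarith [b.winLo_lt_collarLo W.HU half_mem hl2])]
  · -- the window: the straight piece
    apply Subtype.ext
    rw [W.coe_host_circlePt, hostLoop, b.hostLoop_of_mem_window W.HU half_mem hl2 W.hW eighth_pos le_rfl W.hB W.hAB ⟨h1, hu.2⟩, straightPt]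
    have e : cO b.depthSign + b.clockFn W.HU half_mem hl2 u • dLo b.depthSign = lowerPt b.depthSign (b.clockFn W.HU half_mem hl2 u) := rfl
    rw [e, W.blowDown_lowerPt]

/-- **THE REFERENCE HOST ON THE ARC** `[winHi, jHi]`: `ψ⁻¹ (blowDown (bendArc σ (1/8) (psiHi t') 1))`.
[folklore] -/
theorem host_arc {t : ℝ} (ht : t ∈ Icc (b.winHi W.HU half_mem) W.jHi) :
    W.host (circlePt t) = psiN.symm (b.blowDown hcross κ (bendArc b.depthSign (1 / 8) (b.psiHi κ (1 / 2) t) 1)) := by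
  have hκ := W.κ_pos
  have hl2 : (1 / 2 : ℝ) ≤ 1 / 2 := le_rfl
  obtain ⟨c1, c2, c3⟩ := b.core_marks
  obtain ⟨hjc, hjv⟩ := b.juncHi_spec hκ W.HU.cone.spike.seven_le_gapHi
  have hwh := b.winHi_mem_core W.HU half_mem
  have hcore : t ∈ Icc (b.tcHi - b.epsHi / 8) (b.tcHi + b.epsHi / 8) :=
    ⟨by linarith [ht.1, hwh.1], by linarith [ht.2, hjc.2, b.epsHi_bounds.1, show W.jHi = b.juncHi hκ W.HU.cone.spike.seven_le_gapHi from rfl]⟩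
  have hI : t ∈ Ico b.alo (b.alo + 1) := ⟨by linarith [hcore.1, b.epsLo_bounds.1], by linarith [hcore.2]⟩
  have hα : b.alphaHi κ t ∈ Icc (3 / 8 : ℝ) (3 / 4) := by
    constructor
    · rw [← hjv]
      exact (b.strictAntiOn_alphaHi hκ).antitoneOn hcore ⟨hjc.1, by linarith [hjc.2, b.epsHi_bounds.1]⟩ ht.2
    · have := (b.alphaHi_clockHi_mem W.HU half_mem hl2 half_mem_Icc).2
      exact ((b.strictAntiOn_alphaHi hκ).antitoneOn hwh hcore ht.1).trans this.le
  have hcol : t ∉ Ioo (b.collarLo W.HU half_mem) (b.collarHi W.HU half_mem) := fun h ↦ by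
    linarith [h.2, b.collarHi_lt_winHi W.HU half_mem hl2, ht.1]
  apply Subtype.ext
  rw [W.coe_host_circlePt, hostLoop, b.hostLoop_of_not_mem_collar W.HU half_mem hl2 W.hW eighth_pos le_rfl W.hB W.hAB hI hcol,
    Knot.curve_apply, b.bentKnot_circlePt_upperSpike W.HU W.hW half_mem eighth_pos W.hB W.hAB hcore hα]
  rfl

include hrA8 in
/-- **The spiral correspondence**: an upper-spike point of scale `λ₀` with ray scalar `≥ 1/2` is a
reference host point on `[winHi, jHi]`. [folklore] -/
theorem bent_spiral {t : ℝ} (ht : t ∈ Icc (b.tcHi - b.epsHi / 8) (b.tcHi + b.epsHi / 8))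
    (hα : b.alphaHi κ t ∈ Icc (3 / 8 : ℝ) (3 / 4)) (hψ : 1 / 2 ≤ b.psiHi κ lam₀ t) :
    ∃ t' ∈ Icc (b.winHi W.HU half_mem) W.jHi, W.bent hl₀ hrA (circlePt t) = W.host (circlePt t') := by
  have hκ := W.κ_pos
  set ψ := b.psiHi κ lam₀ t with hψdef
  have hψ56 : ψ ≤ 5 / 6 := (psiHi_mem_of_alphaHi hl₀ hα).2
  obtain ⟨hWc, hWv⟩ := b.clockHi_spec W.HU half_mem half_mem_Icc
  obtain ⟨hjc, hjv⟩ := b.juncHi_spec hκ W.HU.cone.spike.seven_le_gapHi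
  have hWv' : b.psiHi κ (1 / 2) (b.winHi W.HU half_mem) = 1 / 2 := hWv
  have hjv' : b.psiHi κ (1 / 2) W.jHi = 5 / 6 := by
    show b.psiHi κ (1 / 2) (b.juncHi hκ W.HU.cone.spike.seven_le_gapHi) = 5 / 6
    simp only [psiHi, hjv, spikeScalar_three_eighths]
  have hwj := W.winHi_le_jHi
  have hcont := (b.contDiff_psiHi κ (1 / 2)).continuous.continuousOn (s := Icc (b.winHi W.HU half_mem) W.jHi)
  obtain ⟨t', ht', ht'v⟩ := intermediate_value_Icc hwj hcont (show ψ ∈ Icc (b.psiHi κ (1 / 2) (b.winHi W.HU half_mem)) (b.psiHi κ (1 / 2) W.jHi) by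
    rw [hWv', hjv']; exact ⟨hψ, hψ56⟩)
  refine ⟨t', ht', ?_⟩
  rw [W.host_arc ht', ht'v]
  apply Subtype.ext
  rw [bent, b.bentKnot_circlePt_upperSpike W.HU W.hW hl₀ hrA W.hB W.hAB ht hα]
  show ((psiN.symm (b.blowDown hcross κ (bendArc b.depthSign rA ψ 1)) : 𝕊 3) : 𝔼 4) =
    ((psiN.symm (b.blowDown hcross κ (bendArc b.depthSign (1 / 8) ψ 1)) : 𝕊 3) : 𝔼 4)
  rw [bendArc_one_eq_of_half_le b.depthSign hrA (by linarith) (rA' := 1 / 8) (by norm_num) (by norm_num) hψ]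

end WallRef

end BandData

end Literature.Topology.FourManifolds
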